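import Mathlib

/-!
# `TiltedLandingLaw421` (crux stmt-RiemannHypothesis-24774, route `EarlyAppointments`, rev 7/8) — negative-side support

`sorry`-free negative lemmas on the RH-free tilted landing engine plus one small-model fact, all on ONE explicit
witness; filed `--supports stmt-RiemannHypothesis-24774` by the RH tribunal's T1 strength-refuter seat (rh-trib-t1-1).
Re-files the content of the bounced p725021 (`¬ TiltedLandingLaw42`, item stmt-RiemannHypothesis-24729, RETIRED at
rev 7 — so the rev-6 text is INLINED; director-rh (CA177)(3)/(CA182)(2)). Self-contained (`import Mathlib` only, no
dependence on the route file), no new definitions. Witness: `F z = (z² + 900)·eᶻ` — real entire of order 1, zeros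
`±30i` simple, `F⁽ⁿ⁾(z) = ((z+n)² − n + 900)·eᶻ`, which is `> 0` on `ℝ` for `n < 900` and acquires the real
double zero `x = −900` exactly at `n = 900`.

* `not_tiltedLandingLaw42Rev6` — the rev-6 engine text (body of the retired decl `…Theses.EarlyAppointments.
  TiltedLandingLaw42`, tree rev 6, ll.165–166, sha16 d1c9244d49ca055b; byte-for-byte the rev-7 `TiltedLandingLaw421`
  text with its three edits undone) is FALSE at the datum `(η,f,x₀,s,hmax,R,Hs,B) = (1/2,F,0,1/4,30,60,30,239)`
  (depth budget `4·hmax/s + B + 1 = 720 < 899`). Class refuted-misstated; repaired statement of record = the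
  planner's `TiltedLandingLaw421`, which this datum misses twice (`3·hmax = 90 ≮ 60`; budget `15121 ≥ 899`).
* `tiltedLandingLaw421_false_without_sqDepth` — LOAD-BEARING `(Hs/s)²`: the rev-7 text with that summand deleted
  from the conclusion (all else verbatim: frame `3·hmax < R`, window `((k:ℝ)+3)·R/2`) is FALSE at the datum
  `(1/2,F,0,1/4,30,100,30,399)` (`4·hmax/s + B + 1 = 880 < 899`): any proof of the crux must use the de Bruijn term.
* `pairExp_meets_law421_conclusion` — the same datum MEETS the conclusion of `TiltedLandingLaw421` (budget
  `480 + 14400 + 399 + 1 ≥ 899`; level `k = 899`, NL event at `x = −900`), i.e. it is not a counterexample to the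
  filed crux (machine check of the T1 round-2 reading "the witness misses the repaired statement").

Truth of `TiltedLandingLaw421` is not claimed either way. Nothing here bears on the truth of RH.
-/

namespace Summit.RiemannHypothesis.RiemannHypothesis.Theorems.TiltedLandingLaw421.Negative

open Complex

/-! ## The witness `F z = (z² + 900)·eᶻ`, handled through its defining equation `hFz` -/

/-- `(30i)·(30i) = −900`. -/
lemma thirtyI_mul_thirtyI : (30 * I : ℂ) * (30 * I) = -900 := by
  linear_combination (900 : ℂ) * I_mul_I

/-- `30i ≠ −30i`. -/
lemma thirtyI_ne_neg : (30 * I : ℂ) ≠ -(30 * I) := by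
  intro h
  have : (60 : ℂ) * I = 0 := by linear_combination h
  simp [I_ne_zero] at this

/-- One differentiation step of the closed form `((z+n)² − n + 900)·eᶻ`. -/
lemma hasDerivAt_pairExp_level (n : ℕ) (z : ℂ) :
    HasDerivAt (fun z : ℂ => ((z + n) ^ 2 - n + 900) * exp z) (((z + (n + 1)) ^ 2 - (n + 1) + 900) * exp z) z := by
  have ha : HasDerivAt (fun z : ℂ => z + n) 1 z := (hasDerivAt_id z).add_const _
  have hc : HasDerivAt (fun z : ℂ => (z + n) ^ 2 - n + 900) (((2 : ℕ) : ℂ) * (z + n) ^ (2 - 1) * 1) z :=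
    ((ha.pow 2).sub_const _).add_const _
  refine (hc.mul (hasDerivAt_exp z)).congr_deriv ?_
  simp only [Nat.cast_ofNat, Nat.reduceSub, pow_one, mul_one]
  ring

variable {F : ℂ → ℂ}

/-- The witness is entire. -/
lemma pairExp_differentiable (hFz : ∀ z : ℂ, F z = (z ^ 2 + 900) * exp z) : Differentiable ℂ F := by
  rw [show F = fun z => (z ^ 2 + 900) * exp z from funext hFz]
  fun_prop

/-- Factorisation at the zero `30i`. -/
lemma pairExp_factor (hFz : ∀ z : ℂ, F z = (z ^ 2 + 900) * exp z) (z : ℂ) :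
    F z = (z - 30 * I) * ((z + 30 * I) * exp z) := by
  rw [hFz]
  linear_combination (exp z) * thirtyI_mul_thirtyI

/-- The zero set of the witness is `{30i, −30i}`. -/
lemma pairExp_eq_zero_iff (hFz : ∀ z : ℂ, F z = (z ^ 2 + 900) * exp z) (w : ℂ) :
    F w = 0 ↔ w = 30 * I ∨ w = -(30 * I) := by
  rw [pairExp_factor hFz, mul_eq_zero, mul_eq_zero, sub_eq_zero]
  have h1 : exp w ≠ 0 := exp_ne_zero w
  have h2 : w + 30 * I = 0 ↔ w = -(30 * I) := by
    constructor
    · intro h; linear_combination h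
    · intro h; rw [h]; ring
  rw [h2]
  tauto

/-- Closed form of all derivatives: `F⁽ⁿ⁾(z) = ((z+n)² − n + 900)·eᶻ`. -/
lemma iteratedDeriv_pairExp (hFz : ∀ z : ℂ, F z = (z ^ 2 + 900) * exp z) (n : ℕ) :
    iteratedDeriv n F = fun z => ((z + n) ^ 2 - n + 900) * exp z := by
  induction n with
  | zero => funext z; simp [hFz]
  | succ n ih =>
    rw [iteratedDeriv_succ, ih]
    funext z
    rw [(hasDerivAt_pairExp_level n z).deriv]
    push_cast
    ring

/-- `F′(w) = ((w+1)² + 899)·eʷ`. -/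
lemma deriv_pairExp (hFz : ∀ z : ℂ, F z = (z ^ 2 + 900) * exp z) (w : ℂ) :
    deriv F w = ((w + 1) ^ 2 - 1 + 900) * exp w := by
  have h := iteratedDeriv_pairExp hFz 1
  rw [iteratedDeriv_one] at h
  rw [h]; push_cast; ring

/-- The witness is real on `ℝ`. -/
lemma pairExp_ofReal (hFz : ∀ z : ℂ, F z = (z ^ 2 + 900) * exp z) (x : ℝ) :
    F (x : ℂ) = (((x ^ 2 + 900) * Real.exp x : ℝ) : ℂ) := by
  rw [hFz]; push_cast; ring

/-- All derivatives are real on `ℝ`, with the closed form. -/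
lemma iteratedDeriv_pairExp_ofReal (hFz : ∀ z : ℂ, F z = (z ^ 2 + 900) * exp z) (n : ℕ) (x : ℝ) :
    iteratedDeriv n F (x : ℂ) = ((((x + n) ^ 2 - n + 900) * Real.exp x : ℝ) : ℂ) := by
  rw [iteratedDeriv_pairExp hFz]; push_cast; ring

/-- Below level `900` no derivative of the witness has a real zero: `Re F⁽ⁿ⁾ > 0` on `ℝ` for `n < 900`. -/
lemma iteratedDeriv_pairExp_re_pos (hFz : ∀ z : ℂ, F z = (z ^ 2 + 900) * exp z) (n : ℕ) (hn : n < 900)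
    (x : ℝ) : 0 < (iteratedDeriv n F (x : ℂ)).re := by
  rw [iteratedDeriv_pairExp_ofReal hFz, ofReal_re]
  apply mul_pos _ (Real.exp_pos x)
  have hn' : (n : ℝ) < 900 := by exact_mod_cast hn
  nlinarith [sq_nonneg (x + n)]

/-- Both zeros are simple. -/
lemma pairExp_order_eq_one (hFz : ∀ z : ℂ, F z = (z ^ 2 + 900) * exp z) (u : ℂ) (hu : F u = 0) :
    analyticOrderAt F u = 1 := by
  have hFa : AnalyticAt ℂ F u := (pairExp_differentiable hFz).analyticAt u
  rw [show (1 : ℕ∞) = ((1 : ℕ) : ℕ∞) from rfl, hFa.analyticOrderAt_eq_natCast]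
  have h60 : (60 : ℂ) * I ≠ 0 := by simp [I_ne_zero]
  rcases (pairExp_eq_zero_iff hFz u).1 hu with rfl | rfl
  · refine ⟨fun z => (z + 30 * I) * exp z, by fun_prop, ?_, ?_⟩
    · refine mul_ne_zero ?_ (exp_ne_zero _)
      intro h; exact h60 (by linear_combination h)
    · exact Filter.Eventually.of_forall fun z => by rw [pow_one, smul_eq_mul, pairExp_factor hFz]
  · refine ⟨fun z => (z - 30 * I) * exp z, by fun_prop, ?_, ?_⟩
    · refine mul_ne_zero ?_ (exp_ne_zero _)
      intro h; exact h60 (by linear_combination -h)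
    · exact Filter.Eventually.of_forall fun z => by rw [pow_one, smul_eq_mul, pairExp_factor hFz]; ring

/-- Both zeros are simple (`toNat` form used by the engine's sums). -/
lemma pairExp_order_toNat (hFz : ∀ z : ℂ, F z = (z ^ 2 + 900) * exp z) (u : ℂ) (hu : F u = 0) :
    (analyticOrderAt F u).toNat = 1 := by
  rw [pairExp_order_eq_one hFz u hu]; rfl

/-- The column window of any radius `r ≥ 0` contains exactly the pair. -/
lemma pairExp_colSet_eq (hFz : ∀ z : ℂ, F z = (z ^ 2 + 900) * exp z) (r : ℝ) (hr : 0 ≤ r) :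
    {u : ℂ | F u = 0 ∧ |u.re - 0| ≤ r} = {30 * I, -(30 * I)} := by
  ext u
  simp only [Set.mem_setOf_eq, Set.mem_insert_iff, Set.mem_singleton_iff, pairExp_eq_zero_iff hFz]
  constructor
  · rintro ⟨h, -⟩; exact h
  · intro h
    refine ⟨h, ?_⟩
    rcases h with rfl | rfl <;> simpa using hr

/-- The right half-slab is empty. -/
lemma pairExp_rightSet_eq (hFz : ∀ z : ℂ, F z = (z ^ 2 + 900) * exp z) (r : ℝ) :
    {u : ℂ | F u = 0 ∧ 0 < u.re ∧ u.re ≤ 0 + r} = ∅ := by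
  ext u
  simp only [Set.mem_setOf_eq, Set.mem_empty_iff_false, iff_false, pairExp_eq_zero_iff hFz, not_and]
  rintro (rfl | rfl) <;> simp

/-- The left half-slab is empty. -/
lemma pairExp_leftSet_eq (hFz : ∀ z : ℂ, F z = (z ^ 2 + 900) * exp z) (r : ℝ) :
    {u : ℂ | F u = 0 ∧ 0 - r ≤ u.re ∧ u.re < 0} = ∅ := by
  ext u
  simp only [Set.mem_setOf_eq, Set.mem_empty_iff_false, iff_false, pairExp_eq_zero_iff hFz, not_and]
  rintro (rfl | rfl) <;> simp

/-- Local polar set of half-width `ρ` around `Re w`: the pair when `|Re w| < ρ` … -/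
lemma pairExp_locSet_eq_pair (hFz : ∀ z : ℂ, F z = (z ^ 2 + 900) * exp z) (ρ : ℝ) (w : ℂ)
    (hw : |w.re| < ρ) : {u : ℂ | F u = 0 ∧ |u.re - w.re| < ρ} = {30 * I, -(30 * I)} := by
  ext u
  simp only [Set.mem_setOf_eq, Set.mem_insert_iff, Set.mem_singleton_iff, pairExp_eq_zero_iff hFz]
  constructor
  · rintro ⟨h, -⟩; exact h
  · intro h
    refine ⟨h, ?_⟩
    rcases h with rfl | rfl
    · simp only [mul_re, re_ofNat, I_re, mul_zero, im_ofNat, I_im, mul_one, sub_self, zero_sub, abs_neg]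
      linarith
    · simp only [neg_re, mul_re, re_ofNat, I_re, mul_zero, im_ofNat, I_im, mul_one, sub_self, neg_zero, zero_sub,
        abs_neg]
      linarith

/-- … and empty when `|Re w| ≥ ρ` (the box edge). -/
lemma pairExp_locSet_eq_empty (hFz : ∀ z : ℂ, F z = (z ^ 2 + 900) * exp z) (ρ : ℝ) (w : ℂ)
    (hw : ¬ |w.re| < ρ) : {u : ℂ | F u = 0 ∧ |u.re - w.re| < ρ} = ∅ := by
  ext u
  simp only [Set.mem_setOf_eq, Set.mem_empty_iff_false, iff_false, pairExp_eq_zero_iff hFz, not_and]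
  rintro (rfl | rfl)
  · simp only [mul_re, re_ofNat, I_re, mul_zero, im_ofNat, I_im, mul_one, sub_self, zero_sub, abs_neg]
    intro h; exact hw (by linarith)
  · simp only [neg_re, mul_re, re_ofNat, I_re, mul_zero, im_ofNat, I_im, mul_one, sub_self, neg_zero, zero_sub,
      abs_neg]
    intro h; exact hw (by linarith)

/-- Order `1 < 2`: `‖F z‖ ≤ 902·exp(2‖z‖¹)`. -/
lemma pairExp_growth (hFz : ∀ z : ℂ, F z = (z ^ 2 + 900) * exp z) (z : ℂ) :
    ‖F z‖ ≤ 902 * Real.exp (2 * ‖z‖ ^ (1 : ℝ)) := by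
  rw [Real.rpow_one]
  have t0 : 0 ≤ ‖z‖ := norm_nonneg z
  have hq := Real.quadratic_le_exp_of_nonneg t0
  have hexp1 : 1 ≤ Real.exp ‖z‖ := Real.one_le_exp t0
  have h1 : ‖z ^ 2 + 900‖ ≤ ‖z‖ ^ 2 + 900 := by
    calc ‖z ^ 2 + 900‖ ≤ ‖z ^ 2‖ + ‖(900 : ℂ)‖ := norm_add_le _ _
      _ = ‖z‖ ^ 2 + 900 := by simp [norm_pow]
  have h2 : ‖exp z‖ ≤ Real.exp ‖z‖ := by rw [norm_exp]; exact Real.exp_le_exp.2 (re_le_norm z)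
  have h3 : ‖z‖ ^ 2 + 900 ≤ 902 * Real.exp ‖z‖ := by nlinarith
  have hE : Real.exp (2 * ‖z‖) = Real.exp ‖z‖ * Real.exp ‖z‖ := by rw [two_mul, Real.exp_add]
  rw [hFz, norm_mul, hE]
  calc ‖z ^ 2 + 900‖ * ‖exp z‖ ≤ (902 * Real.exp ‖z‖) * Real.exp ‖z‖ :=
        mul_le_mul (h1.trans h3) h2 (norm_nonneg _) (by positivity)
    _ = 902 * (Real.exp ‖z‖ * Real.exp ‖z‖) := by ring

/-- On the vertical edges `|Re w| = ρ`, `ρ ≥ 30`, of a box of half-height `30` (where the local polar part is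
empty) the bare logarithmic derivative is small: `‖F′/F(w)‖ = ‖1 + 2w/(w²+900)‖ ≤ 2`. -/
lemma pairExp_edge_bound (hFz : ∀ z : ℂ, F z = (z ^ 2 + 900) * exp z) (ρ : ℝ) (hρ : 30 ≤ ρ) (w : ℂ)
    (hre : |w.re| = ρ) (him : |w.im| ≤ 30) (hFw : F w ≠ 0) : ‖deriv F w / F w‖ ≤ 2 := by
  have hq : w ^ 2 + 900 ≠ 0 := by
    intro h; apply hFw; rw [hFz, h, zero_mul]
  have hquot : deriv F w / F w = 1 + 2 * w / (w ^ 2 + 900) := by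
    rw [deriv_pairExp hFz, hFz]; field_simp; ring
  rw [hquot]
  have hre2 : w.re ^ 2 = ρ ^ 2 := by rw [← sq_abs, hre]
  have him2 : w.im ^ 2 ≤ 900 := by
    have : |w.im| ^ 2 ≤ 30 ^ 2 := pow_le_pow_left₀ (abs_nonneg _) him 2
    rw [sq_abs] at this
    linarith
  have hRe : (w ^ 2 + 900).re = w.re ^ 2 - w.im ^ 2 + 900 := by simp [sq, mul_re]
  have hρ2 : (900 : ℝ) ≤ ρ ^ 2 := by nlinarith
  have hden : ρ ^ 2 ≤ ‖w ^ 2 + 900‖ := by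
    have h := abs_re_le_norm (w ^ 2 + 900)
    rw [hRe, abs_of_nonneg (by linarith)] at h
    linarith
  have hnum : ‖2 * w‖ ≤ 2 * (ρ + 30) := by
    have h := norm_le_abs_re_add_abs_im w
    have h2 : ‖(2 : ℂ)‖ = 2 := by simp
    rw [norm_mul, h2]
    rw [hre] at h
    linarith
  have hpoly : 2 * (ρ + 30) ≤ ρ ^ 2 := by nlinarith [sq_nonneg (ρ - 30)]
  have hfrac : ‖2 * w / (w ^ 2 + 900)‖ ≤ 1 := by
    rw [norm_div, div_le_one (by linarith)]
    linarith
  calc ‖1 + 2 * w / (w ^ 2 + 900)‖ ≤ ‖(1 : ℂ)‖ + ‖2 * w / (w ^ 2 + 900)‖ := norm_add_le _ _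
    _ ≤ 2 := by rw [norm_one]; linarith

/-- Inside the box the level-0 remainder is EXACTLY the tilt `1`: `F′/F(w) − (1/(w − 30i) + 1/(w + 30i)) = 1`. -/
lemma pairExp_interior_eq (hFz : ∀ z : ℂ, F z = (z ^ 2 + 900) * exp z) (w : ℂ) (hFw : F w ≠ 0) :
    deriv F w / F w - ((1 : ℂ) * (w - 30 * I)⁻¹ + 1 * (w - -(30 * I))⁻¹) = 1 := by
  have h1 : w - 30 * I ≠ 0 := sub_ne_zero.2 fun h => hFw ((pairExp_eq_zero_iff hFz w).2 (Or.inl h))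
  have h2 : w - -(30 * I) ≠ 0 := sub_ne_zero.2 fun h => hFw ((pairExp_eq_zero_iff hFz w).2 (Or.inr h))
  have hq : w ^ 2 + 900 ≠ 0 := by
    intro h; apply hFw; rw [hFz, h, zero_mul]
  have hexp : exp w ≠ 0 := exp_ne_zero w
  have hprod : (w - 30 * I) * (w - -(30 * I)) = w ^ 2 + 900 := by
    linear_combination (-1 : ℂ) * thirtyI_mul_thirtyI
  rw [deriv_pairExp hFz, hFz, one_mul, one_mul]
  have e1 : (w - 30 * I)⁻¹ + (w - -(30 * I))⁻¹ = (2 * w) / (w ^ 2 + 900) := by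
    rw [← hprod]; field_simp; ring
  rw [e1]; field_simp; ring

/-- Column-excess hypothesis: holds for every budget `B` (the column carries exactly the pair). -/
lemma pairExp_column (hFz : ∀ z : ℂ, F z = (z ^ 2 + 900) * exp z) (B : ℕ) (r : ℝ) (hr : 1 / 4 ≤ r) :
    (∑ᶠ u ∈ {u : ℂ | F u = 0 ∧ |u.re - 0| ≤ r}, ((analyticOrderAt F u).toNat : ℝ)) - 2 * r / (1 / 4) ≤ B := by
  rw [pairExp_colSet_eq hFz r (by linarith), finsum_mem_pair thirtyI_ne_neg,
    pairExp_order_toNat hFz _ ((pairExp_eq_zero_iff hFz _).2 (Or.inl rfl)),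
    pairExp_order_toNat hFz _ ((pairExp_eq_zero_iff hFz _).2 (Or.inr rfl))]
  push_cast
  have : 2 * r / (1 / 4 : ℝ) = 8 * r := by ring
  rw [this]
  have hB : (0 : ℝ) ≤ B := Nat.cast_nonneg B
  linarith

/-- Half-slab budgets: both half-slabs are EMPTY, so the hypothesis holds as soon as `4R ≤ 1 + B`. -/
lemma pairExp_halfSlabs (hFz : ∀ z : ℂ, F z = (z ^ 2 + 900) * exp z) (R : ℝ) (B : ℕ) (hB : 4 * R ≤ 1 + B)
    (r : ℝ) (hr : 1 / 4 ≤ r) (hrR : r ≤ R) :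
    |(∑ᶠ u ∈ {u : ℂ | F u = 0 ∧ 0 < u.re ∧ u.re ≤ 0 + r}, ((analyticOrderAt F u).toNat : ℝ)) - r / (1 / 4)| ≤ 1 + B ∧
      |(∑ᶠ u ∈ {u : ℂ | F u = 0 ∧ 0 - r ≤ u.re ∧ u.re < 0}, ((analyticOrderAt F u).toNat : ℝ)) - r / (1 / 4)|
        ≤ 1 + B := by
  rw [pairExp_rightSet_eq hFz, pairExp_leftSet_eq hFz, finsum_mem_empty]
  have : r / (1 / 4 : ℝ) = 4 * r := by ring
  rw [this]
  constructor <;> (rw [abs_le]; constructor <;> linarith)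

/-- Level-0 remainder on the box `|Re w| ≤ R/2`, `|Im w| ≤ 30` (`R ≥ 60`): the tilt `1` inside, `≤ 2` on the edge;
both `≤ η/s = (1/2)/(1/4)`. -/
lemma pairExp_remainder (hFz : ∀ z : ℂ, F z = (z ^ 2 + 900) * exp z) (R : ℝ) (hR : 60 ≤ R) (w : ℂ)
    (hre : |w.re - 0| ≤ R / 2) (him : |w.im| ≤ 30) (hFw : F w ≠ 0) :
    ‖deriv F w / F w - ∑ᶠ u ∈ {u : ℂ | F u = 0 ∧ |u.re - w.re| < R / 2},
        ((analyticOrderAt F u).toNat : ℂ) * (w - u)⁻¹‖ ≤ 1 / 2 / (1 / 4) := by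
  have hre' : |w.re| ≤ R / 2 := by simpa only [sub_zero] using hre
  have hrhs : (1 / 2 : ℝ) / (1 / 4) = 2 := by norm_num
  rw [hrhs]
  by_cases hw : |w.re| < R / 2
  · rw [pairExp_locSet_eq_pair hFz _ w hw, finsum_mem_pair thirtyI_ne_neg,
      pairExp_order_toNat hFz _ ((pairExp_eq_zero_iff hFz _).2 (Or.inl rfl)),
      pairExp_order_toNat hFz _ ((pairExp_eq_zero_iff hFz _).2 (Or.inr rfl))]
    push_cast
    rw [pairExp_interior_eq hFz w hFw, norm_one]
    norm_num
  · rw [pairExp_locSet_eq_empty hFz _ w hw, finsum_mem_empty, sub_zero]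
    exact pairExp_edge_bound hFz (R / 2) (by linarith) w (le_antisymm hre' (not_lt.1 hw)) him hFw

/-! ## The three results -/

/-- **The rev-6 text of the tilted landing engine is false** (re-filing of the bounced p725021; class
refuted-misstated). The negated proposition is, byte for byte, the body of the retired route decl
`Summit.RiemannHypothesis.RiemannHypothesis.Theses.EarlyAppointments.TiltedLandingLaw42` (stmt-RiemannHypothesis-24729,
route `route-RiemannHypothesis-EarlyAppointments` rev 6, `Theses/EarlyAppointments.lean` ll.165–166 at sha16
d1c9244d49ca055b): for a large budget `B` the column / half-column hypotheses force no real zeros at all, while a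
constant tilt of `f′/f` is still admitted by the remainder hypothesis. Witness `f z = (z² + 900)·eᶻ`, `η = 1/2`,
`x₀ = 0`, `s = 1/4`, `hmax = Hs = 30`, `R = 60`, `B = 239`: all fifteen hypotheses hold, but
`f⁽ⁿ⁾(x) = ((x+n)² − n + 900)·eˣ > 0` on `ℝ` for `n < 900`, so no level `k ≤ 4·hmax/s + B + 1 = 720` has a real zero
of `Re f⁽ᵏ⁺¹⁾`. Repaired statement of record: the planner's `TiltedLandingLaw421` (stmt-RiemannHypothesis-24774, rev 7),
which this datum misses twice (`3·hmax = 90 ≮ R = 60`; depth budget `480 + (30/(1/4))² + 239 + 1 = 15121 ≥ 899`).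
Nothing here bears on the truth of RH. -/
theorem not_tiltedLandingLaw42Rev6 :
    ¬ (∀ (η : ℝ) (f : ℂ → ℂ) (x₀ s hmax R Hs : ℝ) (B : ℕ), Differentiable ℂ f → (∀ x : ℝ, (f (x : ℂ)).im = 0) → (∃ A' B' ρ : ℝ, ρ < 2 ∧ ∀ z : ℂ, ‖f z‖ ≤ A' * Real.exp (B' * ‖z‖ ^ ρ)) → 0 < s → 2 * s ≤ hmax → 2 * hmax ≤ R → 0 ≤ Hs → (∀ w : ℂ, f w = 0 → |w.im| ≤ Hs) → 2 * Hs ≤ R → (∃ w₀ : ℂ, f w₀ = 0 ∧ w₀.im ≠ 0 ∧ w₀.re = x₀ ∧ |w₀.im| ≤ hmax) → (∀ r : ℝ, s ≤ r → r ≤ R → (∑ᶠ u ∈ {u : ℂ | f u = 0 ∧ |u.re - x₀| ≤ r}, ((analyticOrderAt f u).toNat : ℝ)) - 2 * r / s ≤ B) → (∀ r : ℝ, s ≤ r → r ≤ R → |(∑ᶠ u ∈ {u : ℂ | f u = 0 ∧ x₀ < u.re ∧ u.re ≤ x₀ + r}, ((analyticOrderAt f u).toNat : ℝ)) - r / s|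 ≤ 1 + B ∧ |(∑ᶠ u ∈ {u : ℂ | f u = 0 ∧ x₀ - r ≤ u.re ∧ u.re < x₀}, ((analyticOrderAt f u).toNat : ℝ)) - r / s| ≤ 1 + B) → 0 ≤ η → 2 * η ≤ 1 → (∀ w : ℂ, |w.re - x₀| ≤ R / 2 → |w.im| ≤ hmax → f w ≠ 0 → ‖deriv f w / f w - ∑ᶠ u ∈ {u : ℂ | f u = 0 ∧ |u.re - w.re| < R / 2}, ((analyticOrderAt f u).toNat : ℂ) * (w - u)⁻¹‖ ≤ η / s) → ∃ k : ℕ, (k : ℝ) ≤ 4 * hmax / s + B + 1 ∧ ∃ x : ℝ, |x - x₀| < R / 2 + Real.sqrt k * hmax ∧ ((iteratedDeriv (k + 1) f (x : ℂ)).re = 0 ∧ (iteratedDeriv k f (x : ℂ)).re ≠ 0 ∧ 0 ≤ (iteratedDeriv k f (x : ℂ)).re * (iteratedDeriv (k + 2) f (x : ℂ)).re)) := by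
  intro h
  obtain ⟨F, hFz⟩ : ∃ F : ℂ → ℂ, ∀ z : ℂ, F z = (z ^ 2 + 900) * exp z := ⟨_, fun _ => rfl⟩
  have hzero := pairExp_eq_zero_iff hFz
  obtain ⟨k, hk, x, -, hx, -, -⟩ := h (1 / 2) F 0 (1 / 4) 30 60 30 239 (pairExp_differentiable hFz)
    (fun x => by rw [pairExp_ofReal hFz, ofReal_im]) ⟨902, 2, 1, by norm_num, pairExp_growth hFz⟩
    (by norm_num) (by norm_num) (by norm_num) (by norm_num)
    (fun w hw => by rcases (hzero w).1 hw with rfl | rfl <;> simp) (by norm_num)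
    ⟨30 * I, (hzero _).2 (Or.inl rfl), by simp, by simp, by simp⟩
    (fun r hr _ => pairExp_column hFz 239 r hr) (pairExp_halfSlabs hFz 60 239 (by norm_num))
    (by norm_num) (by norm_num) (fun w hre him hFw => pairExp_remainder hFz 60 (by norm_num) w hre him hFw)
  have hk' : k + 1 < 900 := by
    have e : (4 : ℝ) * 30 / (1 / 4) + ((239 : ℕ) : ℝ) + 1 = 720 := by norm_num
    have h720 : (k : ℝ) ≤ 720 := by linarith [e ▸ hk]
    have : k ≤ 720 := by exact_mod_cast h720
    omega
  exact (iteratedDeriv_pairExp_re_pos hFz (k + 1) hk' x).ne' hx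

/-- **Load-bearing `(Hs/s)²`.** The negated proposition is the rev-7 route decl
`Summit.RiemannHypothesis.RiemannHypothesis.Theses.EarlyAppointments.TiltedLandingLaw421` (stmt-RiemannHypothesis-24774;
`Theses/EarlyAppointments.lean` ll.184–185) with exactly ONE edit: the summand `(Hs / s) ^ 2 +` is deleted from the
depth bound of the conclusion (the frame `3 * hmax < R` and the window `((k : ℝ) + 3) * R / 2` are kept). Witness
`f z = (z² + 900)·eᶻ`, `η = 1/2`, `x₀ = 0`, `s = 1/4`, `hmax = Hs = 30`, `R = 100`, `B = 399`: all sixteen hypotheses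
hold (`3·hmax = 90 < 100`; half-slab budgets `4r ≤ 400 = 1 + B`; remainder `= 1` inside the box `|Re w| ≤ 50`, `≤ 2`
on its edge, `η/s = 2`), but `4·hmax/s + B + 1 = 880` and `f⁽ⁿ⁾ > 0` on `ℝ` for `n < 900`. So the de Bruijn term
cannot be dropped; on the family `(z² + a²)eᶻ`, `s = 1/4`, `B = 4R − 1`, `R = 3a⁺` the landing level is `a² − 1`
against the linear part `16a + 12a`, so no coefficient `< 1/16 − o(1)` of `(Hs/s)²` survives this family either.
Nothing here bears on the truth of RH. -/
theorem tiltedLandingLaw421_false_without_sqDepth :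
    ¬ (∀ (η : ℝ) (f : ℂ → ℂ) (x₀ s hmax R Hs : ℝ) (B : ℕ), Differentiable ℂ f → (∀ x : ℝ, (f (x : ℂ)).im = 0) → (∃ A' B' ρ : ℝ, ρ < 2 ∧ ∀ z : ℂ, ‖f z‖ ≤ A' * Real.exp (B' * ‖z‖ ^ ρ)) → 0 < s → 2 * s ≤ hmax → 2 * hmax ≤ R → 3 * hmax < R → 0 ≤ Hs → (∀ w : ℂ, f w = 0 → |w.im| ≤ Hs) → 2 * Hs ≤ R → (∃ w₀ : ℂ, f w₀ = 0 ∧ w₀.im ≠ 0 ∧ w₀.re = x₀ ∧ |w₀.im| ≤ hmax) → (∀ r : ℝ, s ≤ r → r ≤ R → (∑ᶠ u ∈ {u : ℂ | f u = 0 ∧ |u.re - x₀| ≤ r}, ((analyticOrderAt f u).toNat : ℝ)) - 2 * r / s ≤ B) → (∀ r : ℝ, s ≤ r → r ≤ R → |(∑ᶠ u ∈ {u : ℂ | f u = 0 ∧ x₀ < u.re ∧ u.re ≤ x₀ + r}, ((analyticOrderAt f u).toNat : ℝ)) - r / s| ≤ 1 + B ∧ |(∑ᶠ u ∈ {u : ℂ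 | f u = 0 ∧ x₀ - r ≤ u.re ∧ u.re < x₀}, ((analyticOrderAt f u).toNat : ℝ)) - r / s| ≤ 1 + B) → 0 ≤ η → 2 * η ≤ 1 → (∀ w : ℂ, |w.re - x₀| ≤ R / 2 → |w.im| ≤ hmax → f w ≠ 0 → ‖deriv f w / f w - ∑ᶠ u ∈ {u : ℂ | f u = 0 ∧ |u.re - w.re| < R / 2}, ((analyticOrderAt f u).toNat : ℂ) * (w - u)⁻¹‖ ≤ η / s) → ∃ k : ℕ, (k : ℝ) ≤ 4 * hmax / s + B + 1 ∧ ∃ x : ℝ, |x - x₀| < ((k : ℝ) + 3) * R / 2 ∧ ((iteratedDeriv (k + 1) f (x : ℂ)).re = 0 ∧ (iteratedDeriv k f (x : ℂ)).re ≠ 0 ∧ 0 ≤ (iteratedDeriv k f (x : ℂ)).re * (iteratedDeriv (k + 2) f (x : ℂ)).re)) := by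
  intro h
  obtain ⟨F, hFz⟩ : ∃ F : ℂ → ℂ, ∀ z : ℂ, F z = (z ^ 2 + 900) * exp z := ⟨_, fun _ => rfl⟩
  have hzero := pairExp_eq_zero_iff hFz
  obtain ⟨k, hk, x, -, hx, -, -⟩ := h (1 / 2) F 0 (1 / 4) 30 100 30 399 (pairExp_differentiable hFz)
    (fun x => by rw [pairExp_ofReal hFz, ofReal_im]) ⟨902, 2, 1, by norm_num, pairExp_growth hFz⟩
    (by norm_num) (by norm_num) (by norm_num) (by norm_num) (by norm_num)
    (fun w hw => by rcases (hzero w).1 hw with rfl | rfl <;> simp) (by norm_num)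
    ⟨30 * I, (hzero _).2 (Or.inl rfl), by simp, by simp, by simp⟩
    (fun r hr _ => pairExp_column hFz 399 r hr) (pairExp_halfSlabs hFz 100 399 (by norm_num))
    (by norm_num) (by norm_num) (fun w hre him hFw => pairExp_remainder hFz 100 (by norm_num) w hre him hFw)
  have hk' : k + 1 < 900 := by
    have e : (4 : ℝ) * 30 / (1 / 4) + ((399 : ℕ) : ℝ) + 1 = 880 := by norm_num
    have h880 : (k : ℝ) ≤ 880 := by linarith [e ▸ hk]
    have : k ≤ 880 := by exact_mod_cast h880
    omega
  exact (iteratedDeriv_pairExp_re_pos hFz (k + 1) hk' x).ne' hx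

/-- Small-model fact: at the datum of `tiltedLandingLaw421_false_without_sqDepth` the conclusion of the rev-7 law
`TiltedLandingLaw421` HOLDS, so that datum is not a counterexample to the filed crux: the budget with the quadratic
term is `4·30/(1/4) + (30/(1/4))² + 399 + 1 = 15280 ≥ 899`, and level `k = 899` carries the non-Laguerre event at
`x = −900` (`F⁽⁹⁰⁰⁾(−900) = 0`, `F⁽⁸⁹⁹⁾(−900) = 2e⁻⁹⁰⁰ ≠ 0`, `F⁽⁸⁹⁹⁾·F⁽⁹⁰¹⁾(−900) = 0 ≥ 0`) inside the window
`|x − 0| < (899 + 3)·100/2`. -/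
theorem pairExp_meets_law421_conclusion (hFz : ∀ z : ℂ, F z = (z ^ 2 + 900) * exp z) :
    ∃ k : ℕ, (k : ℝ) ≤ 4 * 30 / (1 / 4) + (30 / (1 / 4)) ^ 2 + (399 : ℕ) + 1 ∧ ∃ x : ℝ,
      |x - 0| < ((k : ℝ) + 3) * 100 / 2 ∧ ((iteratedDeriv (k + 1) F (x : ℂ)).re = 0 ∧
        (iteratedDeriv k F (x : ℂ)).re ≠ 0 ∧ 0 ≤ (iteratedDeriv k F (x : ℂ)).re * (iteratedDeriv (k + 2) F (x : ℂ)).re) := by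
  have e0 : (iteratedDeriv (899 + 1) F ((-900 : ℝ) : ℂ)).re = 0 := by
    rw [iteratedDeriv_pairExp_ofReal hFz, ofReal_re]; push_cast; ring
  have e1 : (iteratedDeriv 899 F ((-900 : ℝ) : ℂ)).re = 2 * Real.exp (-900) := by
    rw [iteratedDeriv_pairExp_ofReal hFz, ofReal_re]; push_cast; ring
  have e2 : (iteratedDeriv (899 + 2) F ((-900 : ℝ) : ℂ)).re = 0 := by
    rw [iteratedDeriv_pairExp_ofReal hFz, ofReal_re]; push_cast; ring
  refine ⟨899, by norm_num, -900, ?_, e0, ?_, ?_⟩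
  · rw [sub_zero, abs_lt]; constructor <;> norm_num
  · rw [e1]; exact mul_ne_zero two_ne_zero (Real.exp_ne_zero _)
  · rw [e1, e2, mul_zero]

end Summit.RiemannHypothesis.RiemannHypothesis.Theorems.TiltedLandingLaw421.Negative
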